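import Mathlib
import HarnessLib
import Literature.AlgebraicGeometry.Ramification.InertiaNormalSylow
import Literature.AlgebraicGeometry.Resolution.ResolutionOfSingularities
import Literature.AlgebraicGeometry.Resolution.BlowupSNC
import Literature.AlgebraicGeometry.Resolution.BoundarySplitting
import Literature.AlgebraicGeometry.Resolution.CanonicalResolutionSmoothCentre
import Literature.AlgebraicGeometry.Resolution.ComponentGluing
import Summits.ResolutionOfSingularities.ResolutionOfSingularities.Theorems.WildQuotientsWildQuotientResolutionTameMoveIter
import Summits.ResolutionOfSingularities.ResolutionOfSingularities.Theorems.WildQuotientsWildQuotientResolutionTameCorePhaseZero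
import Summits.ResolutionOfSingularities.ResolutionOfSingularities.Theorems.WildQuotientsWildQuotientResolutionTameCentreSNC

/-!
# Phase 0 in EVERY dimension for groups with TWO tame cores: two tame moves
# (crux `WildQuotients.WildQuotientResolution`, stub `stub_phaseZeroHighDim`)

Crux stmt-ResolutionOfSingularities-15640 (`WildQuotientResolution`), registered stub `stub_phaseZeroHighDim`.
✓`phaseZero_of_tameCore` (p822102) settles Phase 0 in all dimensions by ONE tame move when a single normal tame
subgroup `M` lies in `⟨h⟩` for every tame `h ≠ 1` of every non-p-closed subgroup. This file runs the
standard-form route through TWO moves — the first genuinely multi-move slice, exercising the whole pipeline: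
iterable move (✓`tameMove'` p822186), SNC of the second centre with the first exceptional divisor
(✓`hasSNCWith_inertLocus_of_hasSNC_singleton` p822334), SNC persistence (tree `HasSNCWith.hasSNC_transform`),
stable lines (✓p821951 + the prime-avoidance lemma `apply_mem_span_of_prime` below for the strict transform),
establishment (✓p821870) and persistence through the union «strict transform ∪ new exceptional divisor»
(✓p822157), and the criterion (✓p821758):

**Theorem** (`phaseZero_of_twoTameCores`). Let `M₁, M₂ ⊴ G` be non-trivial normal subgroups of order prime to
`p` such that every element `h ≠ 1` of order prime to `p` of every subgroup of `G` without a normal Sylow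
`p`-subgroup has `M₁ ≤ ⟨h⟩` or `M₂ ≤ ⟨h⟩` (e.g. `G ⧸ N` a `p`-group with `N` cyclic of order `ℓ₁^a ℓ₂^b`:
the dihedral group `D₁₅` in characteristic `2`). Then the conclusion of `stub_phaseZeroHighDim` holds for every
crux datum, in every dimension: blow up `Z_{M₁}`, then the inert locus of `M₂` on the result.

[OURS · crux stmt-ResolutionOfSingularities-15640 · helper toward `stub_phaseZeroHighDim` (an all-dimensional
two-move SLICE of the stub; NOT a proof of the stub); counted 0; AI-level work, weaker than expert review.]
[folklore]
-/

-- single-problem summit: the doubled namespace component `ResolutionOfSingularities` is forced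
set_option linter.dupNamespace false

noncomputable section

open CategoryTheory AlgebraicGeometry TopologicalSpace IsLocalRing
open Literature.AlgebraicGeometry.Resolution Literature.AlgebraicGeometry.Ramification
open Scheme.IdealSheafData
open Summit.ResolutionOfSingularities.ResolutionOfSingularities.Theorems.WildQuotientResolution.PointBlowupStalkData
open Summit.ResolutionOfSingularities.ResolutionOfSingularities.Theorems.WildQuotientResolution.InertLocusStalk

namespace Summit.ResolutionOfSingularities.ResolutionOfSingularities.Theorems.WildQuotientResolution.StandardForm

/-! ## Prime avoidance for the stable line of a strict transform -/

section Local

variable {R : Type*} [CommRing R] [IsDomain R]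

/-- **Stable line by prime avoidance.** Let `φ` be a ring automorphism, `w` a prime element and `t` an element
with `w ∤ t` whose ideal `(t)` is `φ`-stable in both directions (`φ t, φ⁻¹ t ∈ (t)`), and `I` a `φ`-stable ideal
with `I ≤ (w)` and `w t ∈ I` (geometrically: `I` = the ideal of the `φ`-stable set `V(w) ∪ (V(t) ∩ …)` near a
point of the regular branch `V(w)`). Then `φ w ∈ (w)`: the branch `V(w)` is `φ`-stable. [folklore] -/
theorem apply_mem_span_of_prime (φ : R ≃+* R) {w t : R} (hw : Prime w) (hwt : ¬ w ∣ t) (ht0 : t ≠ 0)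
    (ht : φ t ∈ Ideal.span {t}) (ht' : φ⁻¹ t ∈ Ideal.span {t}) (I : Ideal R)
    (hIφ : ∀ r ∈ I, φ r ∈ I) (hIw : I ≤ Ideal.span {w}) (hwtI : w * t ∈ I) :
    φ w ∈ Ideal.span {w} := by
  obtain ⟨c, hc⟩ := Ideal.mem_span_singleton'.mp ht
  obtain ⟨d, hd⟩ := Ideal.mem_span_singleton'.mp ht'
  -- `c` is a unit: `t = φ (φ⁻¹ t) = φ (d t) = φ d · c t`
  have hcu : IsUnit c := by
    have e0 : φ (φ⁻¹ t) = t := by rw [← RingAut.mul_apply, mul_inv_cancel, RingAut.one_apply]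
    have e : t = φ d * c * t := by
      conv_lhs => rw [← e0, ← hd, map_mul, ← hc]
      ring
    have e2 : (φ d * c - 1) * t = 0 := by rw [sub_mul, one_mul, ← e, sub_self]
    rcases mul_eq_zero.mp e2 with h | h
    · exact isUnit_iff_exists_inv.mpr ⟨φ d, by rw [mul_comm]; exact sub_eq_zero.mp h⟩
    · exact absurd h ht0
  -- `w ∣ φ w · (c t)`
  have h1 : w ∣ φ w * (c * t) := by
    have h2 : φ (w * t) ∈ Ideal.span {w} := hIw (hIφ _ hwtI)
    rw [map_mul, ← hc] at h2
    exact Ideal.mem_span_singleton.mp h2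
  rcases hw.dvd_or_dvd h1 with h | h
  · exact Ideal.mem_span_singleton.mpr h
  · rcases hw.dvd_or_dvd h with h' | h'
    · exact absurd (isUnit_of_dvd_unit h' hcu) hw.not_unit
    · exact absurd h' hwt

end Local

/-! ## The two-move theorem -/

/-- **Phase 0 in every dimension for groups with two tame cores** (crux stmt-ResolutionOfSingularities-15640, a
two-move SLICE of `stub_phaseZeroHighDim`). See the module docstring. [folklore] -/
theorem phaseZero_of_twoTameCores (p : ℕ) (hp : p.Prime) (k : Type) [Field k] [CharP k p]
    (X' X₁ : Scheme.{0}) (f : X₁ ⟶ Spec (.of k)) (q : X' ⟶ X₁) (G : Type) [Group G] [Finite G]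
    (ρ : G →* Aut X') (hfaith : Function.Injective ρ)
    [IsSeparated f] [LocallyOfFiniteType f] [QuasiCompact f] [IsIntegral X']
    (hreg : Scheme.IsRegular X') [IsFinite q] (hρ : ∀ g : G, (ρ g).hom ≫ q = q)
    (M₁ M₂ : Subgroup G) [M₁.Normal] [M₂.Normal] (hM₁ : M₁ ≠ ⊥) (hM₂ : M₂ ≠ ⊥)
    (hcop₁ : (Nat.card M₁).Coprime p) (hcop₂ : (Nat.card M₂).Coprime p)
    (hcore : ∀ H : Subgroup G, ¬ HasNormalSylow p H → ∀ h ∈ H, h ≠ 1 → (orderOf h).Coprime p →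
      M₁ ≤ Subgroup.zpowers h ∨ M₂ ≤ Subgroup.zpowers h) :
    ∃ (Xs : Scheme.{0}) (π : Xs ⟶ X') (ρs : G →* Aut Xs), IsProper π ∧ IsBirational π ∧
      IsIntegral Xs ∧ Scheme.IsRegular Xs ∧ (∀ g : G, (ρs g).hom ≫ π = π ≫ (ρ g).hom) ∧
      (∀ x : Xs, HasNormalSylow p (inertiaSubgroup ρs x)) ∧
      ∀ x : Xs, ∃ U : Xs.Opens, IsAffineOpen U ∧ x ∈ U ∧ ∀ g : G, (ρs g).hom ⁻¹ᵁ U = U := by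
  classical
  haveI : Fact p.Prime := ⟨hp⟩
  -- the crux datum in iterable form
  set s₀ : X' ⟶ Spec (.of k) := q ≫ f with hs₀
  obtain ⟨hρ₀, hcov₀⟩ := iterHypotheses_of_cruxData X' X₁ f q ρ hρ
  haveI : IsLocallyNoetherian X' := LocallyOfFiniteType.isLocallyNoetherian s₀
  -- MOVE 1 along `Z_{M₁}`
  obtain ⟨X1, π₁, ρ₁, hπ₁p, hbir₁, hX1, hreg₁, hequiv₁, hbl₁, hle₁, hcov₁, hfaith₁, hρ₁⟩ :=
    tameMove' p hp k X' s₀ G ρ hfaith hreg hρ₀ hcov₀ M₁ hM₁ hcop₁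
  haveI := hπ₁p; haveI := hX1
  haveI : IsLocallyNoetherian X1 := LocallyOfFiniteType.isLocallyNoetherian (π₁ ≫ s₀)
  -- MOVE 2 along `Z_{M₂}` on `X1`
  obtain ⟨X2, π₂, ρ₂, hπ₂p, hbir₂, hX2, hreg₂, hequiv₂, hbl₂, hle₂, hcov₂, -, hρ₂⟩ :=
    tameMove' p hp k X1 (π₁ ≫ s₀) G ρ₁ hfaith₁ hreg₁ hρ₁ hcov₁ M₂ hM₂ hcop₂
  haveI := hπ₂p; haveI := hX2
  haveI : IsLocallyNoetherian X2 := LocallyOfFiniteType.isLocallyNoetherian (π₂ ≫ π₁ ≫ s₀)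
  -- the centres and exceptional divisors
  have hZ₁ : IsClosed {y : X' | M₁ ≤ inertiaSubgroup ρ y} :=
    PointMoveNoNpcCurves.isClosed_setOf_le_inertia s₀ ρ hρ₀ M₁
  set Z₁ : Closeds X' := ⟨{y : X' | M₁ ≤ inertiaSubgroup ρ y}, hZ₁⟩ with hZ₁def
  set 𝒥₁ : X'.IdealSheafData := vanishingIdeal Z₁ with h𝒥₁def
  set D₁ : X1.IdealSheafData := 𝒥₁.comap π₁ with hD₁def
  have hZ₂ : IsClosed {y : X1 | M₂ ≤ inertiaSubgroup ρ₁ y} :=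
    PointMoveNoNpcCurves.isClosed_setOf_le_inertia (π₁ ≫ s₀) ρ₁ hρ₁ M₂
  set Z₂ : Closeds X1 := ⟨{y : X1 | M₂ ≤ inertiaSubgroup ρ₁ y}, hZ₂⟩ with hZ₂def
  set 𝒥₂ : X1.IdealSheafData := vanishingIdeal Z₂ with h𝒥₂def
  set S₁ : X2.IdealSheafData := strictTransformIdeal π₂ 𝒥₂ D₁ with hS₁def
  set D₂ : X2.IdealSheafData := 𝒥₂.comap π₂ with hD₂def
  -- residue characteristics
  have hcharX : ∀ z : X', CharP (ResidueField (X'.presheaf.stalk z)) p := fun z =>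
    (((IsLocalRing.residue (X'.presheaf.stalk z)).comp ((X'.presheaf.germ ⊤ z trivial).hom.comp
      ((s₀.appTop).hom.comp (Scheme.ΓSpecIso (.of k)).inv.hom))).charP_iff_charP p).mp inferInstance
  have hchar₁ : ∀ z : X1, CharP (ResidueField (X1.presheaf.stalk z)) p := fun z =>
    (((IsLocalRing.residue (X1.presheaf.stalk z)).comp ((X1.presheaf.germ ⊤ z trivial).hom.comp
      (((π₁ ≫ s₀).appTop).hom.comp (Scheme.ΓSpecIso (.of k)).inv.hom))).charP_iff_charP p).mp inferInstance
  have hchar₂ : ∀ z : X2, CharP (ResidueField (X2.presheaf.stalk z)) p := fun z =>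
    (((IsLocalRing.residue (X2.presheaf.stalk z)).comp ((X2.presheaf.germ ⊤ z trivial).hom.comp
      (((π₂ ≫ π₁ ≫ s₀).appTop).hom.comp (Scheme.ΓSpecIso (.of k)).inv.hom))).charP_iff_charP p).mp
      inferInstance
  -- SNC of `[D₁]` on `X1`
  have hC₁ : Scheme.IsRegular 𝒥₁.subscheme :=
    isRegular_subscheme_vanishingIdeal_inertLocus_of_coprime ρ M₁ p hZ₁ (fun x _ => hreg x)
      (fun x _ => hcharX x) hcop₁
  have hsnc₁ : HasSNC [D₁] := by
    have h := (hasSNCWith_nil_of_isRegular hreg hC₁).hasSNC_transform hbl₁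
    simpa [hD₁def] using h
  -- supports and their stability
  have hD₁supp : (D₁.support : Set X1) = π₁.base ⁻¹' {y : X' | M₁ ≤ inertiaSubgroup ρ y} := by
    rw [hD₁def, support_comap]
    change π₁.base ⁻¹' ((𝒥₁.support : Closeds X') : Set X') = _
    rw [h𝒥₁def, Scheme.IdealSheafData.coe_support_vanishingIdeal]
    rfl
  have hcomm₁ : ∀ g : G, π₁.base ∘ (ρ₁ g).hom.base = (ρ g).hom.base ∘ π₁.base := fun g => by
    funext y
    have e := Scheme.Hom.comp_apply (ρ₁ g).hom π₁ y
    rw [hequiv₁ g, Scheme.Hom.comp_apply] at e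
    exact e.symm
  have hD₁stab : ∀ g : G, (ρ₁ g).hom.base ⁻¹' (D₁.support : Set X1) = D₁.support := fun g => by
    rw [hD₁supp, ← Set.preimage_comp, hcomm₁ g, Set.preimage_comp, preimage_inertLocus_of_normal ρ g M₁]
  have hD₂supp : (D₂.support : Set X2) = π₂.base ⁻¹' {y : X1 | M₂ ≤ inertiaSubgroup ρ₁ y} := by
    rw [hD₂def, support_comap]
    change π₂.base ⁻¹' ((𝒥₂.support : Closeds X1) : Set X1) = _
    rw [h𝒥₂def, Scheme.IdealSheafData.coe_support_vanishingIdeal]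
    rfl
  have hcomm₂ : ∀ g : G, π₂.base ∘ (ρ₂ g).hom.base = (ρ₁ g).hom.base ∘ π₂.base := fun g => by
    funext y
    have e := Scheme.Hom.comp_apply (ρ₂ g).hom π₂ y
    rw [hequiv₂ g, Scheme.Hom.comp_apply] at e
    exact e.symm
  have hD₂stab : ∀ g : G, (ρ₂ g).hom.base ⁻¹' (D₂.support : Set X2) = D₂.support := fun g => by
    rw [hD₂supp, ← Set.preimage_comp, hcomm₂ g, Set.preimage_comp, preimage_inertLocus_of_normal ρ₁ g M₂]
  -- the total transform `A = π₂⁻¹ supp D₁` of the first exceptional divisor: stable, carried by `S₁ ∪ D₂`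
  set A : Closeds X2 := (D₁.support).preimage π₂.continuous with hAdef
  have hAstab : ∀ g : G, (ρ₂ g).hom.base ⁻¹' (A : Set X2) = A := fun g => by
    change (ρ₂ g).hom.base ⁻¹' (π₂.base ⁻¹' (D₁.support : Set X1)) = π₂.base ⁻¹' (D₁.support : Set X1)
    rw [← Set.preimage_comp, hcomm₂ g, Set.preimage_comp, hD₁stab g]
  have hAsub : (A : Set X2) ⊆ (S₁.support : Set X2) ∪ D₂.support :=
    preimage_support_subset_strict_union_exceptional π₂ 𝒥₂ D₁
  have hSA : (S₁.support : Set X2) ⊆ A := fun y hy =>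
    mem_support_of_mem_support_strictTransformIdeal hy
  -- SNC of `[S₁, D₂]` on `X2`
  have hsncW : HasSNCWith [D₁] 𝒥₂ :=
    hasSNCWith_inertLocus_of_hasSNC_singleton ρ₁ p M₂ hchar₁ hcop₂ hZ₂ D₁ hsnc₁ hD₁stab
  have hsnc₂ : HasSNC [S₁, D₂] := by
    have h := hsncW.hasSNC_transform hbl₂
    simpa [hS₁def, hD₂def] using h
  have hS₁mem : S₁ ∈ [S₁, D₂] := by simp
  have hD₂mem : D₂ ∈ [S₁, D₂] := by simp
  -- invariant structure map on `X2`, closed inert loci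
  have hZ' : ∀ K : Subgroup G, IsClosed {x : X2 | K ≤ inertiaSubgroup ρ₂ x} := fun K =>
    PointMoveNoNpcCurves.isClosed_setOf_le_inertia (π₂ ≫ π₁ ≫ s₀) ρ₂ hρ₂ K
  -- THE MODEL
  have hequiv : ∀ g : G, (ρ₂ g).hom ≫ (π₂ ≫ π₁) = (π₂ ≫ π₁) ≫ (ρ g).hom := fun g => by
    rw [← Category.assoc, hequiv₂ g, Category.assoc, hequiv₁ g, Category.assoc]
  refine ⟨X2, π₂ ≫ π₁, ρ₂, inferInstance, ComponentGluing.IsBirational.comp hbir₂ hbir₁, hX2, hreg₂,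
    hequiv, fun x => ?_, hcov₂⟩
  haveI := hchar₂ x
  haveI := hreg₂ x
  by_contra hnpc
  have htame := hcore (inertiaSubgroup ρ₂ x) hnpc
  -- boundary family: the members of `[S₁, D₂]` through `x`
  haveI hTfin : Finite {D' : X2.IdealSheafData // D' ∈ [S₁, D₂] ∧ x ∈ D'.support} :=
    (((List.finite_toSet [S₁, D₂]).subset
      (fun D' (h : D' ∈ [S₁, D₂] ∧ x ∈ D'.support) => h.1)).to_subtype :
      Finite {D' : X2.IdealSheafData | D' ∈ [S₁, D₂] ∧ x ∈ D'.support})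
  let T := {D' : X2.IdealSheafData // D' ∈ [S₁, D₂] ∧ x ∈ D'.support}
  haveI : Fintype T := Fintype.ofFinite T
  let n := Fintype.card T
  let e : T ≃ Fin n := Fintype.equivFin T
  -- the snc data at `x`
  obtain ⟨hregx, u, hu, ⟨ι, hιinj, hι⟩, -⟩ := hsnc₂ x
  have hrsop : IsRsopPart (u ∘ id) := isRsopPart_comp_of_rsop rfl u hu id Function.injective_id
  let z : Fin n → X2.presheaf.stalk x := fun i => u (ι (e.symm i))
  have hzT : ∀ D' : T, z (e D') = u (ι D') := fun D' => by
    simp only [z, Equiv.symm_apply_apply]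
  have hιT : ∀ D' : T, stalkIdeal D'.1 x = Ideal.span {u (ι D')} := fun D' => hι D'
  -- every member of `[S₁, D₂]` through `x` has stalk `(u (ι D'))` equal to the vanishing-ideal stalk of its support
  have hvs : ∀ D' : T, stalkIdeal (vanishingIdeal D'.1.support) x = Ideal.span {u (ι D')} := fun D' => by
    rw [hsnc₂.vanishingIdeal_support D'.2.1, hιT D']
  refine hnpc (hasNormalSylow_inertia_of_standardForm ρ₂ p x fun a τ hkey hτ =>
    ⟨n, z, fun i => hu ▸ Ideal.subset_span ⟨_, rfl⟩, fun i => hrsop.not_mem_sq _, fun g i => ?_,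
      fun g hg1 hg => ?_⟩)
  · -- (hstab) for the member `D' = e.symm i`
    let D' : T := e.symm i
    have hzi : z i = u (ι D') := rfl
    rw [hzi]
    by_cases hD'2 : D'.1 = D₂
    · -- the new exceptional divisor: its support is `G`-stable
      refine apply_mem_span_of_stalkIdeal_eq_span ρ₂ x a τ hkey hτ D₂.support
        (fun g => hD₂stab (g : G)) ?_ g
      rw [← hD'2]; exact hvs D'
    · -- the strict transform `S₁`: prime avoidance inside the stable total transform `A`
      have hD'1 : D'.1 = S₁ := by
        rcases List.mem_pair.mp D'.2.1 with h | h
        · exact h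
        · exact absurd h hD'2
      let w := u (ι D')
      have hw : Prime w := hrsop.prime (ι D')
      have hSx : stalkIdeal (vanishingIdeal S₁.support) x = Ideal.span {w} := by
        rw [← hD'1]; exact hvs D'
      -- the auxiliary element `t`: the equation of `D₂` if `x ∈ supp D₂`, else `1`
      have key : ∃ t : X2.presheaf.stalk x, ¬ w ∣ t ∧ t ≠ 0 ∧ τ g t ∈ Ideal.span {t} ∧
          (τ g)⁻¹ t ∈ Ideal.span {t} ∧ t ∈ stalkIdeal (vanishingIdeal D₂.support) x := by
        by_cases hxD₂ : x ∈ D₂.support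
        · let E : T := ⟨D₂, hD₂mem, hxD₂⟩
          have hne : ι D' ≠ ι E := fun h => hD'2 (congrArg Subtype.val (hιinj h))
          have htE : u (ι E) ∈ stalkIdeal (vanishingIdeal D₂.support) x := by
            rw [hvs E]; exact Ideal.mem_span_singleton_self _
          refine ⟨u (ι E), hrsop.not_dvd hne, hrsop.ne_zero (ι E), ?_, ?_, htE⟩
          · have h := apply_mem_stalkIdeal_vanishingIdeal ρ₂ x a τ hkey hτ D₂.support
              (fun g => hD₂stab (g : G)) g htE
            rwa [hvs E] at h
          · have h := apply_mem_stalkIdeal_vanishingIdeal ρ₂ x a τ hkey hτ D₂.support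
              (fun g => hD₂stab (g : G)) g⁻¹ htE
            rwa [hvs E, map_inv] at h
        · refine ⟨1, fun h => hw.not_unit (isUnit_of_dvd_one h), one_ne_zero, by simp, by simp, ?_⟩
          rw [hsnc₂.vanishingIdeal_support hD₂mem, stalkIdeal_eq_top_of_not_mem_support hxD₂]
          exact Submodule.mem_top
      obtain ⟨t, hwt, ht0, ht, ht', htD₂⟩ := key
      -- `I = I(A)_x` is `τ g`-stable, `≤ (w)`, and contains `w t`
      have hIφ : ∀ r ∈ stalkIdeal (vanishingIdeal A) x, τ g r ∈ stalkIdeal (vanishingIdeal A) x :=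
        fun r hr => apply_mem_stalkIdeal_vanishingIdeal ρ₂ x a τ hkey hτ A (fun g => hAstab (g : G)) g hr
      have hIw : stalkIdeal (vanishingIdeal A) x ≤ Ideal.span {w} := by
        rw [← hSx]
        exact stalkIdeal_mono (vanishingIdeal_antimono (show (S₁.support : Closeds X2) ≤ A from hSA)) x
      have hwtI : w * t ∈ stalkIdeal (vanishingIdeal A) x := by
        have hle : vanishingIdeal (S₁.support ⊔ D₂.support) ≤ vanishingIdeal A :=
          vanishingIdeal_antimono (show A ≤ S₁.support ⊔ D₂.support from hAsub)
        refine stalkIdeal_mono hle x ?_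
        rw [vanishingIdeal_sup, stalkIdeal_inf]
        exact ⟨hSx ▸ Ideal.mul_mem_right _ _ (Ideal.mem_span_singleton_self w),
          Ideal.mul_mem_left _ _ htD₂⟩
      exact Ideal.mem_sup_left
        (apply_mem_span_of_prime (τ g) hw hwt ht0 ht ht' _ hIφ hIw hwtI)
  · -- (hfix) for a tame `g ≠ 1` of `I_x`: `M₁ ≤ ⟨g⟩` or `M₂ ≤ ⟨g⟩`
    have hg1' : (g : G) ≠ 1 := fun h => hg1 (Subtype.ext h)
    have hprime := isPrime_augIdeal ρ₂ p x a τ hkey hτ g hg g.2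
    -- a member of the boundary through `x` whose vanishing-ideal stalk lies in `𝔞_{τ g}` does the job
    have finish : ∀ D₀ : X2.IdealSheafData, D₀ ∈ [S₁, D₂] →
        stalkIdeal (vanishingIdeal D₀.support) x ≤ augIdeal (τ g) →
        ∃ i, z i ∈ augIdeal (τ g) ⊔ maximalIdeal (X2.presheaf.stalk x) ^ 2 := by
      intro D₀ hD₀ hle
      have hxD₀ : x ∈ D₀.support := by
        by_contra hx0
        rw [hsnc₂.vanishingIdeal_support hD₀, stalkIdeal_eq_top_of_not_mem_support hx0, top_le_iff] at hle
        exact hprime.ne_top hle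
      refine ⟨e ⟨D₀, hD₀, hxD₀⟩, ?_⟩
      rw [hzT]
      exact Ideal.mem_sup_left (hle ((hvs ⟨D₀, hD₀, hxD₀⟩) ▸ Ideal.mem_span_singleton_self _))
    rcases htame (g : G) g.2 hg1' (by rwa [Subgroup.orderOf_coe]) with hM | hM
    · -- `M₁ ≤ ⟨g⟩`: persistence through `π₂⁻¹ supp D₁ ⊆ supp S₁ ∪ supp D₂`
      have hD : {y : X1 | Subgroup.zpowers (g : G) ≤ inertiaSubgroup ρ₁ y} ⊆ (D₁.support : Set X1) := by
        intro y hy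
        rw [hD₁supp]
        exact le_trans (le_trans hM hy) (hle₁ y)
      rcases stalkIdeal_le_augIdeal_or_of_preimage_subset_union ρ₂ p x a τ hkey hτ ρ₁ π₂ hequiv₂ g hg g.2
          (hZ' _) (D₁.support : Set X1) hD S₁.support D₂.support hAsub with h | h
      · exact finish S₁ hS₁mem h
      · exact finish D₂ hD₂mem h
    · -- `M₂ ≤ ⟨g⟩`: establishment by the second move
      have hW : {y : X1 | Subgroup.zpowers (g : G) ≤ inertiaSubgroup ρ₁ y} ⊆ (Z₂ : Set X1) :=
        fun y hy => le_trans hM hy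
      have hxD₂ : x ∈ D₂.support := by
        change x ∈ (D₂.support : Set X2)
        rw [hD₂supp]
        exact le_trans (le_trans hM ((Subgroup.zpowers_le).mpr g.2)) (hle₂ x)
      let E : T := ⟨D₂, hD₂mem, hxD₂⟩
      have htD : u (ι E) ∈ stalkIdeal (𝒥₂.comap π₂) x := by
        rw [← hD₂def, hιT E]; exact Ideal.mem_span_singleton_self _
      refine ⟨e E, ?_⟩
      rw [hzT]
      exact Ideal.mem_sup_left
        (mem_augIdeal_of_mem_stalkIdeal_comap ρ₂ ρ₁ π₂ hequiv₂ p x a τ hkey hτ g hg g.2 Z₂ le_rfl hW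
          (hZ' _) htD)

end Summit.ResolutionOfSingularities.ResolutionOfSingularities.Theorems.WildQuotientResolution.StandardForm

end
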